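import Mathlib
import Literature.NumberTheory.LFunctions.MertensFirstVonMangoldtUpper
import HarnessLib

/-!
# Route `IntegerScrew` — Abel summation against `ψ₁(n) = Σ_{k ≤ n} Λ(k)/k` with Chebyshev-strength bounds
# (the «Abel step» of CONTINUUM-LIMIT §25.3)

The Green-function, energy and exit-density bounds of the exit-death flow (CONTINUUM-LIMIT §25, THEOREM A) all
reduce to one elementary device: for a non-increasing weight `φ ≥ 0`,

  `Σ_{n ≤ N} (Λ(n)/n) φ(n)` versus `Σ_{2 ≤ n ≤ N} (log n − log(n−1)) φ(n)` (`≤ ∫₀^{log N} φ∘exp`),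

with an error controlled by `φ(1)` times a two-sided Chebyshev-strength Mertens-I constant
(`−c′ ≤ ψ₁(n) − log n ≤ c`).  This file proves it by a one-line induction (no by-parts lemma is needed:
the Abel remainder `(ψ₁(N) − log N − c)·φ(N)` is carried along and has the right sign), with the constants as
HYPOTHESES, and instantiates the upper half with the tree's `c = 39/50`
(`Literature.NumberTheory.LFunctions.MertensFirstUpper.sum_vonMangoldt_div_le_log_add`):

* `sum_vonMangoldt_div_mul_le_of_psi_le` / `sum_log_sub_log_mul_le_sum_vonMangoldt_div_mul_of_le_psi` — the two
  Abel inequalities with hypothetical constants;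
* **`sum_vonMangoldt_div_mul_antitone_le`** — `Σ_{n ≤ N} (Λ(n)/n) φ(n) ≤ (39/50)·φ(1) + Σ_{2 ≤ n ≤ N}(log n − log(n−1)) φ(n)`
  for every `φ : ℕ → ℝ` non-increasing and non-negative on `[1, N]`;
* `sum_log_sub_log_mul_le_integral` — `Σ_{2 ≤ n ≤ N} (log n − log(n−1)) f(log n) ≤ ∫₀^{log N} f` for `f` antitone on
  `[0, log N]`;
* **`sum_vonMangoldt_div_mul_comp_log_le_integral`** — `Σ_{n ≤ N} (Λ(n)/n) f(log n) ≤ (39/50)·f(0) + ∫₀^{log N} f`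
  (`f ≥ 0` antitone on `[0, log N]`);
* **`sum_vonMangoldt_div_mul_inv_sq_le`** — the instance `f(t) = B/(s + t)²` (`s > 0`, `B ≥ 0`):
  `Σ_{n ≤ N} (Λ(n)/n)·B/(s + log n)² ≤ (39/50)·B/s² + B·(1/s − 1/(s + log N))`, the inequality that drives the
  downward induction `Γ(x) ≤ A·log R/log x` of §25.3.

RH-free, walk-free, elementary.  Nothing in this file bears on the truth of RH.
References: CONTINUUM-LIMIT §25.3 (rh-explicit A6-PIVOT); Hardy–Wright Thm 424 [HardyWright2008]; M. Suzuki,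
J. Lond. Math. Soc. (2) 108 (2023) 1448–1487 [Suzuki2023] for the screw matrices this serves.
-/

noncomputable section

set_option linter.dupNamespace false -- D-0017: `Summit.<S>.<S>.…` is the designed namespace

namespace Summit.RiemannHypothesis.RiemannHypothesis.Theorems.IntegerScrew

open Finset Real
open ArithmeticFunction (vonMangoldt)

/-! ### The Abel inequalities with hypothetical Mertens constants -/

/-- `ψ₁(N) := Σ_{n ∈ [1, N]} Λ(n)/n` splits off its last term. -/
theorem sum_Icc_vonMangoldt_div_succ (N : ℕ) :
    ∑ n ∈ Icc 1 (N + 1), vonMangoldt n / n = ∑ n ∈ Icc 1 N, vonMangoldt n / n + vonMangoldt (N + 1) / (N + 1 : ℕ) := by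
  rw [Finset.sum_Icc_succ_top (by omega)]

/-- **Abel step, upper half (hypothetical constant).**  If `ψ₁(n) ≤ log n + c` for `1 ≤ n ≤ N` and
`φ` is non-increasing on `[1, N]`, then for every `1 ≤ N′ ≤ N`:
`Σ_{n ≤ N′} (Λ(n)/n) φ(n) ≤ c·φ(1) + Σ_{2 ≤ n ≤ N′} (log n − log(n−1)) φ(n) + (ψ₁(N′) − log N′ − c)·φ(N′)`
(the last term is `≤ 0` when `φ(N′) ≥ 0`). -/
theorem sum_vonMangoldt_div_mul_le_of_psi_le {N : ℕ} {c : ℝ} {φ : ℕ → ℝ}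
    (hψ : ∀ n, 1 ≤ n → n ≤ N → ∑ k ∈ Icc 1 n, vonMangoldt k / k ≤ Real.log n + c)
    (hφ : ∀ n, 1 ≤ n → n + 1 ≤ N → φ (n + 1) ≤ φ n) :
    ∀ N', 1 ≤ N' → N' ≤ N →
      ∑ n ∈ Icc 1 N', vonMangoldt n / n * φ n ≤
        c * φ 1 + ∑ n ∈ Icc 2 N', (Real.log n - Real.log (n - 1 : ℕ)) * φ n +
          (∑ k ∈ Icc 1 N', vonMangoldt k / k - Real.log N' - c) * φ N' := by
  intro N' hN'1 hN'N
  induction N' with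
  | zero => omega
  | succ m ih =>
    rcases Nat.eq_zero_or_pos m with hm | hm
    · -- N' = 1: both sides are `0`
      subst hm
      simp [ArithmeticFunction.vonMangoldt_apply_one]
    · have ih' := ih hm (by omega)
      have hmono : φ (m + 1) ≤ φ m := hφ m hm (by omega)
      have hψm : ∑ k ∈ Icc 1 m, vonMangoldt k / k ≤ Real.log m + c := hψ m hm (by omega)
      rw [sum_Icc_vonMangoldt_div_succ m, Finset.sum_Icc_succ_top (by omega : 1 ≤ m + 1),
        Finset.sum_Icc_succ_top (by omega : 2 ≤ m + 1)]
      have hcast : ((m + 1 : ℕ) - 1 : ℕ) = m := by omega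
      rw [hcast]
      -- (ψ₁(m) − log m − c)(φ(m+1) − φ(m)) ≥ 0 closes the step
      nlinarith [mul_nonneg_of_nonpos_of_nonpos (sub_nonpos.2 (by linarith [hψm] :
        ∑ k ∈ Icc 1 m, vonMangoldt k / k - Real.log m ≤ c)) (sub_nonpos.2 hmono)]

/-- **Abel step, lower half (hypothetical constant).**  If `log n − c′ ≤ ψ₁(n)` for `1 ≤ n ≤ N` and `φ` is
non-increasing on `[1, N]`, then for `1 ≤ N′ ≤ N`:
`Σ_{2 ≤ n ≤ N′}(log n − log(n−1)) φ(n) − c′·φ(1) + (ψ₁(N′) − log N′ + c′)·φ(N′) ≤ Σ_{n ≤ N′} (Λ(n)/n) φ(n)`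
(the correction term is `≥ 0` when `φ(N′) ≥ 0`). -/
theorem sum_log_sub_log_mul_le_sum_vonMangoldt_div_mul_of_le_psi {N : ℕ} {c' : ℝ} {φ : ℕ → ℝ}
    (hψ : ∀ n, 1 ≤ n → n ≤ N → Real.log n - c' ≤ ∑ k ∈ Icc 1 n, vonMangoldt k / k)
    (hφ : ∀ n, 1 ≤ n → n + 1 ≤ N → φ (n + 1) ≤ φ n) :
    ∀ N', 1 ≤ N' → N' ≤ N →
      ∑ n ∈ Icc 2 N', (Real.log n - Real.log (n - 1 : ℕ)) * φ n - c' * φ 1 +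
          (∑ k ∈ Icc 1 N', vonMangoldt k / k - Real.log N' + c') * φ N' ≤
        ∑ n ∈ Icc 1 N', vonMangoldt n / n * φ n := by
  intro N' hN'1 hN'N
  induction N' with
  | zero => omega
  | succ m ih =>
    rcases Nat.eq_zero_or_pos m with hm | hm
    · subst hm
      simp [ArithmeticFunction.vonMangoldt_apply_one]
    · have ih' := ih hm (by omega)
      have hmono : φ (m + 1) ≤ φ m := hφ m hm (by omega)
      have hψm : Real.log m - c' ≤ ∑ k ∈ Icc 1 m, vonMangoldt k / k := hψ m hm (by omega)
      rw [sum_Icc_vonMangoldt_div_succ m, Finset.sum_Icc_succ_top (by omega : 1 ≤ m + 1),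
        Finset.sum_Icc_succ_top (by omega : 2 ≤ m + 1)]
      have hcast : ((m + 1 : ℕ) - 1 : ℕ) = m := by omega
      rw [hcast]
      nlinarith [mul_nonneg (sub_nonneg.2 (by linarith [hψm] :
        -c' ≤ ∑ k ∈ Icc 1 m, vonMangoldt k / k - Real.log m)) (sub_nonneg.2 hmono)]

/-- **Abel step, upper half, unconditional** (constant `39/50` from the tree's Mertens-I upper bound): for
`φ : ℕ → ℝ` non-increasing and non-negative on `[1, N]`,
`Σ_{n ≤ N} (Λ(n)/n) φ(n) ≤ (39/50)·φ(1) + Σ_{2 ≤ n ≤ N} (log n − log(n−1)) φ(n)`. -/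
theorem sum_vonMangoldt_div_mul_antitone_le {N : ℕ} (hN : 1 ≤ N) {φ : ℕ → ℝ}
    (hφ : ∀ n, 1 ≤ n → n + 1 ≤ N → φ (n + 1) ≤ φ n) (hφN : 0 ≤ φ N) :
    ∑ n ∈ Icc 1 N, vonMangoldt n / n * φ n ≤
      39 / 50 * φ 1 + ∑ n ∈ Icc 2 N, (Real.log n - Real.log (n - 1 : ℕ)) * φ n := by
  have h := sum_vonMangoldt_div_mul_le_of_psi_le (N := N) (c := 39 / 50) (φ := φ)
    (fun n hn _ => Literature.NumberTheory.LFunctions.MertensFirstUpper.sum_vonMangoldt_div_le_log_add hn)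
    hφ N hN le_rfl
  have hlast : (∑ k ∈ Icc 1 N, vonMangoldt k / k - Real.log N - 39 / 50) * φ N ≤ 0 :=
    mul_nonpos_of_nonpos_of_nonneg
      (by linarith [Literature.NumberTheory.LFunctions.MertensFirstUpper.sum_vonMangoldt_div_le_log_add hN])
      hφN
  linarith

/-! ### The logarithmic Riemann sum against the integral -/

/-- For `f` antitone on `[0, log N]`: `Σ_{2 ≤ n ≤ N} (log n − log(n−1)) f(log n) ≤ ∫₀^{log N} f`
(on `[log(n−1), log n]`, `f ≥ f(log n)`). -/
theorem sum_log_sub_log_mul_le_integral {N : ℕ} (hN : 1 ≤ N) {f : ℝ → ℝ}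
    (hf : AntitoneOn f (Set.Icc 0 (Real.log N))) :
    ∑ n ∈ Icc 2 N, (Real.log n - Real.log (n - 1 : ℕ)) * f (Real.log n) ≤
      ∫ t in (0 : ℝ)..Real.log N, f t := by
  -- write the integral as a sum over the adjacent intervals [log k, log (k+1)], k = 1 … N−1
  set a : ℕ → ℝ := fun k => Real.log ((k + 1 : ℕ) : ℝ) with ha
  have ha0 : a 0 = 0 := by simp [ha]
  have haN : a (N - 1) = Real.log N := by
    simp only [ha, Nat.sub_add_cancel hN]
  have hamono : Monotone a := fun i j hij => by
    simp only [ha]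
    exact Real.log_le_log (by positivity) (by exact_mod_cast Nat.succ_le_succ hij)
  have ha_le : ∀ k, k ≤ N - 1 → a k ≤ Real.log N := fun k hk => haN ▸ hamono hk
  have ha_ge : ∀ k, 0 ≤ a k := fun k => ha0 ▸ hamono (Nat.zero_le k)
  have hint : ∀ k < N - 1, IntervalIntegrable f MeasureTheory.volume (a k) (a (k + 1)) := by
    intro k hk
    refine (hf.mono ?_).intervalIntegrable
    rw [Set.uIcc_of_le (hamono (Nat.le_succ k))]
    exact Set.Icc_subset_Icc (ha_ge k) (ha_le (k + 1) (by omega))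
  have hsplit := intervalIntegral.sum_integral_adjacent_intervals hint
  rw [ha0, haN] at hsplit
  rw [← hsplit]
  -- reindex the left sum: n = k + 2… rather k + 1 + 1; compare termwise
  have hre : ∑ n ∈ Icc 2 N, (Real.log n - Real.log (n - 1 : ℕ)) * f (Real.log n) =
      ∑ k ∈ Finset.range (N - 1), (a (k + 1) - a k) * f (a (k + 1)) := by
    refine Finset.sum_nbij' (fun n => n - 2) (fun k => k + 2) ?_ ?_ ?_ ?_ ?_
    · intro n hn; simp only [mem_Icc] at hn; simp only [Finset.mem_range]; omega
    · intro k hk; simp only [Finset.mem_range] at hk; simp only [mem_Icc]; omega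
    · intro n hn; simp only [mem_Icc] at hn; omega
    · intro k hk; omega
    · intro n hn
      simp only [mem_Icc] at hn
      simp only [ha]
      have h1 : (n - 2 + 1 + 1 : ℕ) = n := by omega
      have h2 : (n - 2 + 1 : ℕ) = n - 1 := by omega
      rw [h1, h2]
  rw [hre]
  refine Finset.sum_le_sum fun k hk => ?_
  have hk' : k < N - 1 := Finset.mem_range.1 hk
  have hle : a k ≤ a (k + 1) := hamono (Nat.le_succ k)
  -- (a(k+1) − a k) f(a(k+1)) = ∫ const ≤ ∫ f
  calc (a (k + 1) - a k) * f (a (k + 1)) = ∫ _ in a k..a (k + 1), f (a (k + 1)) := by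
        rw [intervalIntegral.integral_const, smul_eq_mul]
    _ ≤ ∫ t in a k..a (k + 1), f t := by
        refine intervalIntegral.integral_mono_on hle intervalIntegrable_const (hint k hk') ?_
        intro t ht
        exact hf ⟨(ha_ge k).trans ht.1, ht.2.trans (ha_le (k + 1) (by omega))⟩
          ⟨(ha_ge k).trans (ht.1.trans ht.2), ha_le (k + 1) (by omega)⟩ ht.2

/-- **Abel step against the integral**: for `f ≥ 0` antitone on `[0, log N]`,
`Σ_{n ≤ N} (Λ(n)/n) f(log n) ≤ (39/50)·f(0) + ∫₀^{log N} f`. -/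
theorem sum_vonMangoldt_div_mul_comp_log_le_integral {N : ℕ} (hN : 1 ≤ N) {f : ℝ → ℝ}
    (hf : AntitoneOn f (Set.Icc 0 (Real.log N))) (hf0 : ∀ t ∈ Set.Icc 0 (Real.log N), 0 ≤ f t) :
    ∑ n ∈ Icc 1 N, vonMangoldt n / n * f (Real.log n) ≤
      39 / 50 * f 0 + ∫ t in (0 : ℝ)..Real.log N, f t := by
  have hlogN : 0 ≤ Real.log N := Real.log_natCast_nonneg N
  have hφ : ∀ n, 1 ≤ n → n + 1 ≤ N → f (Real.log (n + 1 : ℕ)) ≤ f (Real.log n) := by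
    intro n hn hnN
    have h0 : 0 ≤ Real.log n := Real.log_natCast_nonneg n
    have hle : Real.log n ≤ Real.log (n + 1 : ℕ) :=
      Real.log_le_log (by exact_mod_cast hn) (by exact_mod_cast Nat.le_succ n)
    have hup : Real.log (n + 1 : ℕ) ≤ Real.log N :=
      Real.log_le_log (by positivity) (by exact_mod_cast hnN)
    exact hf ⟨h0, hle.trans hup⟩ ⟨h0.trans hle, hup⟩ hle
  have hφN : 0 ≤ f (Real.log N) := hf0 _ ⟨hlogN, le_rfl⟩
  have h1 := sum_vonMangoldt_div_mul_antitone_le hN (φ := fun n => f (Real.log n)) hφ hφN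
  simp only [Nat.cast_one, Real.log_one] at h1
  have h2 := sum_log_sub_log_mul_le_integral hN hf
  linarith

/-! ### The instance `f(t) = B/(s+t)²` -/

/-- `∫₀^T B/(s+t)² dt = B(1/s − 1/(s+T))` for `s > 0`, `T ≥ 0`. -/
theorem integral_inv_sq_shift {s T B : ℝ} (hs : 0 < s) (hT : 0 ≤ T) :
    ∫ t in (0 : ℝ)..T, B / (s + t) ^ 2 = B * (1 / s - 1 / (s + T)) := by
  have hderiv : ∀ t ∈ Set.uIcc 0 T, HasDerivAt (fun t => -B / (s + t)) (B / (s + t) ^ 2) t := by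
    intro t ht
    rw [Set.uIcc_of_le hT] at ht
    have hst : s + t ≠ 0 := by linarith [ht.1]
    have h1 : HasDerivAt (fun y : ℝ => s + y) 1 t := (hasDerivAt_id t).const_add s
    have h3 : HasDerivAt (fun y : ℝ => -B * (s + y)⁻¹) (-B * (-1 / (s + t) ^ 2)) t :=
      (h1.inv hst).const_mul (-B)
    have hfun : (fun y : ℝ => -B / (s + y)) = fun y => -B * (s + y)⁻¹ := by
      funext y; rw [div_eq_mul_inv]
    rw [hfun]
    convert h3 using 1
    field_simp
  have hcont : ContinuousOn (fun t => B / (s + t) ^ 2) (Set.uIcc 0 T) := by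
    refine ContinuousOn.div continuousOn_const (by fun_prop) ?_
    intro t ht
    rw [Set.uIcc_of_le hT] at ht
    have : 0 < s + t := by linarith [ht.1]
    positivity
  rw [intervalIntegral.integral_eq_sub_of_hasDerivAt hderiv (hcont.intervalIntegrable)]
  have h0 : s + 0 ≠ 0 := by linarith
  have h1 : s + T ≠ 0 := by linarith
  field_simp
  ring

/-- **The driving inequality of §25.3**: for `s > 0`, `B ≥ 0`, `N ≥ 1`:
`Σ_{n ≤ N} (Λ(n)/n) · B/(s + log n)² ≤ (39/50)·B/s² + B·(1/s − 1/(s + log N))`. -/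
theorem sum_vonMangoldt_div_mul_inv_sq_le {N : ℕ} (hN : 1 ≤ N) {s B : ℝ} (hs : 0 < s) (hB : 0 ≤ B) :
    ∑ n ∈ Icc 1 N, vonMangoldt n / n * (B / (s + Real.log n) ^ 2) ≤
      39 / 50 * (B / s ^ 2) + B * (1 / s - 1 / (s + Real.log N)) := by
  have hlogN : 0 ≤ Real.log N := Real.log_natCast_nonneg N
  set f : ℝ → ℝ := fun t => B / (s + t) ^ 2 with hf
  have hanti : AntitoneOn f (Set.Icc 0 (Real.log N)) := by
    intro x hx y hy hxy
    simp only [hf]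
    have hx0 : 0 < s + x := by linarith [hx.1]
    exact div_le_div_of_nonneg_left hB (by positivity) (by nlinarith [hx.1, hy.1])
  have hnn : ∀ t ∈ Set.Icc 0 (Real.log N), 0 ≤ f t := fun t ht => by
    simp only [hf]; positivity
  have h := sum_vonMangoldt_div_mul_comp_log_le_integral hN hanti hnn
  simp only [hf, add_zero] at h
  rw [integral_inv_sq_shift hs hlogN] at h
  exact h

/-- **The Green-function weight, simple form**: for `1 ≤ N`, `0 < s`, `0 ≤ B`,
`Σ_{n ≤ N} Λ(n)/n · B/(s + log n)² ≤ (39/50)·B/s² + B/s` (drop the negative term of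
`sum_vonMangoldt_div_mul_inv_sq_le`; the form used for the exit Green function when `N` is not tracked). -/
theorem sum_vonMangoldt_div_mul_inv_sq_le_simple {N : ℕ} (hN : 1 ≤ N) {s B : ℝ} (hs : 0 < s) (hB : 0 ≤ B) :
    ∑ n ∈ Icc 1 N, vonMangoldt n / n * (B / (s + Real.log n) ^ 2) ≤ 39 / 50 * (B / s ^ 2) + B / s := by
  have h := sum_vonMangoldt_div_mul_inv_sq_le hN hs hB
  have hlogN : 0 ≤ Real.log N := Real.log_natCast_nonneg N
  have h1 : 0 ≤ B * (1 / (s + Real.log N)) := by positivity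
  have h2 : B * (1 / s - 1 / (s + Real.log N)) ≤ B / s := by
    rw [mul_sub, mul_one_div]; linarith
  linarith

end Summit.RiemannHypothesis.RiemannHypothesis.Theorems.IntegerScrew

end
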